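import Literature.MathematicalPhysics.QuantumLattice.TwoSpeciesCoordinates
import HarnessLib

/-!
# Sector coordinates: norms and the Hubbard form on a sector `(N↑, N↓) = (a, b)`

Trunk T-QLATTICE, family `hubbard`. Sequel to `TwoSpeciesCoordinates`: given explicit enumerations
`sa : Fin p → Finset Λ` of the `a`-subsets and `sb : Fin q → Finset Λ` of the `b`-subsets of the site
set (`IsSubsetEnum`), a vector `ψ` of the sector `(a, b)` is described by the `p × q` array
`W i j = coeffMatrix ψ (sa i) (sb j)`, and

* `‖ψ‖² = Σ_{ij} |W i j|²` (`sector_star_dotProduct_self`);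
* `⟨ψ, H ψ⟩ = Σ_{ij} conj W_{ij} ((K_a W)_{ij} + (W K_b)_{ij} + U |sa i ∩ sb j| W_{ij})`
  (`sector_star_dotProduct_hamiltonian`), Lieb's first-quantised form of the Hubbard Hamiltonian in
  the sector: `K_a`, `K_b` the spinless hopping matrices of `a` resp. `b` fermions
  (`hoppingMatrix G t` restricted to the enumerated subsets) and the double occupancy
  `|α ∩ β|` (Lieb, PRL 62 (1989) 1201, eq. (4); Lieb–Wu, PRL 20 (1968) 1445, eq. (3));
* real-valued packaging for numerical certificates: with integer tables `Ka`, `Kb`, `d` matching the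
  hopping entries and the double occupancies, `Re ⟨ψ, ψ⟩ = normSqW W` and
  `Re ⟨ψ, H(t, U) ψ⟩ = hopForm Ka Kb W + U · dblForm d W` (`re_sector_hamiltonian_eq`), affine in `U`;
* `ofSectorArray`: the inverse direction (any array gives a sector vector with these coordinates),
  used for trial states.

Everything is proved; finite-cluster certificates (e.g. the Hubbard plaquette) instantiate `sa`,
`sb` with literal enumerations checked by `decide`.
-/

noncomputable section

namespace Literature.MathematicalPhysics.QuantumLattice

open Matrix Finset LiebThm1

namespace TwoSpecies

variable {Λ : Type*} [LinearOrder Λ] [Fintype Λ]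

/-! ### Enumerations of `k`-subsets -/

/-- `sa : Fin p → Finset Λ` enumerates the `a`-element subsets of `Λ` without repetition.
[folklore] -/
structure IsSubsetEnum (a : ℕ) {p : ℕ} (sa : Fin p → Finset Λ) : Prop where
  /-- no repetitions -/
  inj : Function.Injective sa
  /-- the values are exactly the `a`-subsets -/
  image_eq : (univ : Finset (Fin p)).image sa = univ.filter fun α : Finset Λ => α.card = a

namespace IsSubsetEnum

variable {a p : ℕ} {sa : Fin p → Finset Λ}

/-- Each enumerated subset has `a` elements. [folklore] -/
theorem card_eq (h : IsSubsetEnum a sa) (i : Fin p) : (sa i).card = a := by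
  have : sa i ∈ (univ : Finset (Fin p)).image sa := mem_image_of_mem sa (mem_univ i)
  rw [h.image_eq, mem_filter] at this
  exact this.2

/-- A sum over all subsets of a function supported on `a`-subsets is the sum over the enumeration.
[folklore] -/
theorem sum_eq {M : Type*} [AddCommMonoid M] (h : IsSubsetEnum a sa) (f : Finset Λ → M)
    (hf : ∀ α, α.card ≠ a → f α = 0) : ∑ α, f α = ∑ i, f (sa i) := by
  rw [← Finset.sum_filter_of_ne (p := fun α : Finset Λ => α.card = a)
    (fun α _ hα => by_contra fun h' => hα (hf α h')), ← h.image_eq,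
    Finset.sum_image fun i _ j _ hij => h.inj hij]

end IsSubsetEnum

/-! ### Norm and Hamiltonian in sector coordinates -/

variable {a b p q : ℕ} {sa : Fin p → Finset Λ} {sb : Fin q → Finset Λ}

/-- **Norm in sector coordinates**: `⟨ψ, ψ⟩ = Σ_{ij} |W(ψ)(sa i, sb j)|²` for `ψ` in the sector
`(a, b)`. Lieb, PRL 62 (1989) 1201, proof of Theorem 1. [cite: LiebPRL1989, proof of Theorem 1] -/
theorem sector_star_dotProduct_self (ha : IsSubsetEnum a sa) (hb : IsSubsetEnum b sb)
    {ψ : Fock (Orb Λ)} (hψ : IsInSector a b ψ) :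
    star ψ ⬝ᵥ ψ = ∑ i : Fin p, ∑ j : Fin q, ((‖coeffMatrix ψ (sa i) (sb j)‖ ^ 2 : ℝ) : ℂ) := by
  rw [isInSector_iff_coeffMatrix] at hψ
  rw [star_dotProduct_self_eq_sum_coeffMatrix]
  rw [ha.sum_eq _ fun α hα => Finset.sum_eq_zero fun β _ => by
    rw [hψ α β (fun h => hα h.1)]; simp]
  refine Finset.sum_congr rfl fun i _ => hb.sum_eq _ fun β hβ => ?_
  rw [hψ (sa i) β (fun h => hβ h.2)]; simp

/-- **Inner product in sector coordinates**: `⟨ψ, φ⟩ = Σ_{ij} conj W(ψ)_{ij} W(φ)_{ij}` whenever `ψ`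
lies in the sector `(a, b)` (no assumption on `φ`). [folklore] -/
theorem sector_star_dotProduct (ha : IsSubsetEnum a sa) (hb : IsSubsetEnum b sb)
    {ψ : Fock (Orb Λ)} (hψ : IsInSector a b ψ) (φ : Fock (Orb Λ)) :
    star ψ ⬝ᵥ φ = ∑ i : Fin p, ∑ j : Fin q,
      star (coeffMatrix ψ (sa i) (sb j)) * coeffMatrix φ (sa i) (sb j) := by
  rw [isInSector_iff_coeffMatrix] at hψ
  rw [star_dotProduct_eq_sum_coeffMatrix]
  rw [ha.sum_eq _ fun α hα => Finset.sum_eq_zero fun β _ => by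
    rw [hψ α β (fun h => hα h.1), star_zero, zero_mul]]
  refine Finset.sum_congr rfl fun i _ => hb.sum_eq _ fun β hβ => ?_
  rw [hψ (sa i) β (fun h => hβ h.2), star_zero, zero_mul]

omit [Fintype Λ] in
/-- `Σ_x [x ∈ α] c [x ∈ β] = |α ∩ β| c` (the double-occupancy count). [folklore] -/
theorem sum_ite_mem_mul_ite_mem [Fintype Λ] (α β : Finset Λ) (c : ℂ) :
    ∑ x : Λ, (if x ∈ α then (1 : ℂ) else 0) * c * (if x ∈ β then (1 : ℂ) else 0) =
      ((α ∩ β).card : ℂ) * c := by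
  have : ∀ x : Λ, (if x ∈ α then (1 : ℂ) else 0) * c * (if x ∈ β then (1 : ℂ) else 0) =
      if x ∈ α ∩ β then c else 0 := by
    intro x
    by_cases h1 : x ∈ α <;> by_cases h2 : x ∈ β <;> simp [h1, h2]
  rw [Finset.sum_congr rfl fun x _ => this x, Finset.sum_ite_mem, univ_inter, Finset.sum_const,
    nsmul_eq_mul]

variable (G : SimpleGraph Λ) [DecidableRel G.Adj]

/-- **The Hubbard Hamiltonian in sector coordinates** (Lieb's eq. (4) restricted to the sector
`(a, b)` and written in the enumerations): for `ψ` in the sector,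
`⟨ψ, H ψ⟩ = Σ_{ij} conj W_{ij} (Σ_{i'} K(sa i, sa i') W_{i'j} + Σ_{j'} K(sb j, sb j') W_{ij'} + U |sa i ∩ sb j| W_{ij})`,
`K = hoppingMatrix G t`. Lieb, PRL 62 (1989) 1201, eq. (4); Lieb–Wu, PRL 20 (1968) 1445, eq. (3).
[cite: LiebPRL1989, eq. (4)] -/
theorem sector_star_dotProduct_hamiltonian (ha : IsSubsetEnum a sa) (hb : IsSubsetEnum b sb)
    (t U : ℝ) {ψ : Fock (Orb Λ)} (hψ : IsInSector a b ψ) :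
    star ψ ⬝ᵥ (hamiltonian G t U *ᵥ ψ) = ∑ i : Fin p, ∑ j : Fin q,
      star (coeffMatrix ψ (sa i) (sb j)) *
        ((∑ i' : Fin p, hoppingMatrix G t (sa i) (sa i') * coeffMatrix ψ (sa i') (sb j)) +
          (∑ j' : Fin q, hoppingMatrix G t (sb j) (sb j') * coeffMatrix ψ (sa i) (sb j')) +
          (U : ℂ) * ((sa i ∩ sb j).card : ℂ) * coeffMatrix ψ (sa i) (sb j)) := by
  have hψ' := (isInSector_iff_coeffMatrix a b ψ).1 hψ
  rw [sector_star_dotProduct ha hb hψ, coeffMatrix_hamiltonian_mulVec]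
  set W := coeffMatrix ψ with hW
  refine Finset.sum_congr rfl fun i _ => Finset.sum_congr rfl fun j _ => ?_
  -- `(K W)(sa i, sb j)`: only `a`-subsets contribute
  have h1 : (hoppingMatrix G t * W) (sa i) (sb j) =
      ∑ i' : Fin p, hoppingMatrix G t (sa i) (sa i') * W (sa i') (sb j) := by
    rw [Matrix.mul_apply]
    exact ha.sum_eq _ fun α hα => by rw [hψ' α (sb j) (fun h => hα h.1), mul_zero]
  -- `(W K)(sa i, sb j)`: only `b`-subsets contribute; `K` is symmetric
  have h2 : (W * hoppingMatrix G t) (sa i) (sb j) =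
      ∑ j' : Fin q, hoppingMatrix G t (sb j) (sb j') * W (sa i) (sb j') := by
    rw [Matrix.mul_apply, hb.sum_eq _ fun β hβ => by rw [hψ' (sa i) β (fun h => hβ h.2), zero_mul]]
    exact Finset.sum_congr rfl fun j' _ => by rw [hoppingMatrix_transpose_apply, mul_comm]
  -- the interaction: `Σ_x (n_x W n_x)(α, β) = |α ∩ β| W(α, β)`
  have h3 : ((U : ℂ) • ∑ x : Λ, numberAt x * W * numberAt x) (sa i) (sb j) =
      (U : ℂ) * ((sa i ∩ sb j).card : ℂ) * W (sa i) (sb j) := by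
    rw [Matrix.smul_apply, Matrix.sum_apply, smul_eq_mul, mul_assoc, ← sum_ite_mem_mul_ite_mem]
    congr 1
    refine Finset.sum_congr rfl fun x _ => ?_
    rw [numberAt_eq_diagonal, Matrix.mul_diagonal, Matrix.diagonal_mul]
  rw [Matrix.add_apply, Matrix.add_apply, h1, h2, h3]

/-! ### Real packaging with integer tables -/

/-- `Σ_{ij} |W i j|²`. [folklore] -/
def normSqW (W : Fin p → Fin q → ℂ) : ℝ := ∑ i, ∑ j, ‖W i j‖ ^ 2

/-- The hopping form `Re Σ_{ij} conj W_{ij} ((Ka W)_{ij} + (W Kbᵀ)_{ij})` of integer tables. [folklore] -/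
def hopForm (Ka : Fin p → Fin p → ℤ) (Kb : Fin q → Fin q → ℤ) (W : Fin p → Fin q → ℂ) : ℝ :=
  (∑ i, ∑ j, star (W i j) *
    ((∑ i', (Ka i i' : ℂ) * W i' j) + ∑ j', (Kb j j' : ℂ) * W i j')).re

/-- The double-occupancy form `Σ_{ij} d i j |W i j|²` of a table `d`. [folklore] -/
def dblForm (d : Fin p → Fin q → ℕ) (W : Fin p → Fin q → ℂ) : ℝ := ∑ i, ∑ j, (d i j : ℝ) * ‖W i j‖ ^ 2

/-- `Re ⟨ψ, ψ⟩ = normSqW W(ψ)` on the sector. [folklore] -/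
theorem re_sector_norm_eq (ha : IsSubsetEnum a sa) (hb : IsSubsetEnum b sb) {ψ : Fock (Orb Λ)}
    (hψ : IsInSector a b ψ) :
    (star ψ ⬝ᵥ ψ).re = normSqW fun i j => coeffMatrix ψ (sa i) (sb j) := by
  rw [sector_star_dotProduct_self ha hb hψ, normSqW]
  simp only [Complex.re_sum, Complex.ofReal_re]

/-- **`Re ⟨ψ, H(t, U) ψ⟩ = hopForm Ka Kb W(ψ) + U · dblForm d W(ψ)`** on the sector, for integer tables
`Ka`, `Kb`, `d` that match the hopping entries between the enumerated subsets and the double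
occupancies. This is the affine-in-`U` form consumed by the numerical certificates.
Lieb, PRL 62 (1989) 1201, eq. (4). [cite: LiebPRL1989, eq. (4)] -/
theorem re_sector_hamiltonian_eq (ha : IsSubsetEnum a sa) (hb : IsSubsetEnum b sb) (t U : ℝ)
    {Ka : Fin p → Fin p → ℤ} {Kb : Fin q → Fin q → ℤ} {d : Fin p → Fin q → ℕ}
    (hKa : ∀ i i', hoppingMatrix G t (sa i) (sa i') = (Ka i i' : ℂ))
    (hKb : ∀ j j', hoppingMatrix G t (sb j) (sb j') = (Kb j j' : ℂ))
    (hd : ∀ i j, (sa i ∩ sb j).card = d i j) {ψ : Fock (Orb Λ)} (hψ : IsInSector a b ψ) :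
    (star ψ ⬝ᵥ (hamiltonian G t U *ᵥ ψ)).re =
      hopForm Ka Kb (fun i j => coeffMatrix ψ (sa i) (sb j)) +
        U * dblForm d (fun i j => coeffMatrix ψ (sa i) (sb j)) := by
  rw [sector_star_dotProduct_hamiltonian G ha hb t U hψ, hopForm, dblForm]
  simp only [hKa, hKb, hd]
  set W : Fin p → Fin q → ℂ := fun i j => coeffMatrix ψ (sa i) (sb j) with hW
  have hterm : ∀ i j, star (coeffMatrix ψ (sa i) (sb j)) *
      ((∑ i', (Ka i i' : ℂ) * coeffMatrix ψ (sa i') (sb j)) +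
        (∑ j', (Kb j j' : ℂ) * coeffMatrix ψ (sa i) (sb j')) +
        (U : ℂ) * (d i j : ℂ) * coeffMatrix ψ (sa i) (sb j)) =
      star (W i j) * ((∑ i', (Ka i i' : ℂ) * W i' j) + ∑ j', (Kb j j' : ℂ) * W i j') +
        ((U * (d i j : ℝ) * ‖W i j‖ ^ 2 : ℝ) : ℂ) := by
    intro i j
    have h : star (W i j) * ((U : ℂ) * (d i j : ℂ) * W i j) =
        (((U * (d i j : ℝ) * ‖W i j‖ ^ 2 : ℝ)) : ℂ) := by
      rw [Complex.star_def]
      push_cast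
      rw [← Complex.mul_conj']
      ring
    rw [← h, hW]
    ring
  have hd' : ∑ i, ∑ j, U * (d i j : ℝ) * ‖W i j‖ ^ 2 =
      U * ∑ i, ∑ j, (d i j : ℝ) * ‖coeffMatrix ψ (sa i) (sb j)‖ ^ 2 := by
    rw [Finset.mul_sum]
    refine Finset.sum_congr rfl fun i _ => ?_
    rw [Finset.mul_sum]
    exact Finset.sum_congr rfl fun j _ => by simp only [hW]; ring
  simp only [hterm, Finset.sum_add_distrib, Complex.add_re, Complex.re_sum, Complex.ofReal_re, hd']
  rfl

/-! ### Trial states from arrays -/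

/-- The sector vector with prescribed coordinate array `w` (zero outside the enumerated subsets).
[folklore] -/
def ofSectorArray (sa : Fin p → Finset Λ) (sb : Fin q → Finset Λ) (w : Fin p → Fin q → ℂ) :
    Fock (Orb Λ) :=
  ofCoeffMatrix fun α β => ∑ i, ∑ j, if sa i = α ∧ sb j = β then w i j else 0

/-- The coefficient matrix of `ofSectorArray` at enumerated subsets is the array. [folklore] -/
theorem coeffMatrix_ofSectorArray (ha : IsSubsetEnum a sa) (hb : IsSubsetEnum b sb)
    (w : Fin p → Fin q → ℂ) (i : Fin p) (j : Fin q) :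
    coeffMatrix (ofSectorArray sa sb w) (sa i) (sb j) = w i j := by
  rw [ofSectorArray, coeffMatrix_ofCoeffMatrix]
  rw [Finset.sum_eq_single i, Finset.sum_eq_single j]
  · simp
  · intro j' _ hj'
    rw [if_neg fun h => hj' (hb.inj h.2)]
  · simp
  · intro i' _ hi'
    exact Finset.sum_eq_zero fun j' _ => by rw [if_neg fun h => hi' (ha.inj h.1)]
  · simp

/-- `ofSectorArray` lies in the sector `(a, b)`. [folklore] -/
theorem isInSector_ofSectorArray (ha : IsSubsetEnum a sa) (hb : IsSubsetEnum b sb)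
    (w : Fin p → Fin q → ℂ) : IsInSector a b (ofSectorArray sa sb w) := by
  refine isInSector_ofCoeffMatrix fun α β hαβ => Finset.sum_eq_zero fun i _ =>
    Finset.sum_eq_zero fun j _ => ?_
  rw [if_neg]
  rintro ⟨rfl, rfl⟩
  exact hαβ ⟨ha.card_eq i, hb.card_eq j⟩

/-! ### Entries of parity-twisted products -/

omit [Fintype Λ] in
/-- `(P W)_{αβ} = (-1)^{#α} W_{αβ}`. [folklore] -/
theorem upParity_mul_apply [Fintype Λ] (W : Matrix (Finset Λ) (Finset Λ) ℂ) (α β : Finset Λ) :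
    (upParity * W : Matrix (Finset Λ) (Finset Λ) ℂ) α β = (-1) ^ α.card * W α β := by
  rw [upParity, diagonal_mul]

/-! ### Integer-valued matrix entries (for evaluation by `decide`) -/

section IntEntries

variable {ι : Type*} [LinearOrder ι]

/-- The Jordan–Wigner sign as an integer: `jwSign i s = jwInt i s`. [folklore] -/
def jwInt (i : ι) (s : Finset ι) : ℤ := (-1) ^ (s.filter (· < i)).card

/-- `jwSign` is the cast of `jwInt`. [folklore] -/
theorem jwSign_eq_cast (i : ι) (s : Finset ι) : jwSign i s = (jwInt i s : ℂ) := by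
  simp [jwSign, jwInt]

/-- The entry `(c_x)_{s u}` as an integer. [folklore] -/
def annInt (x : ι) (s u : Finset ι) : ℤ := if x ∉ s ∧ u = insert x s then jwInt x s else 0

/-- `annihilation x s u` is the cast of `annInt x s u`. [folklore] -/
theorem annihilation_eq_cast (x : ι) (s u : Finset ι) : annihilation x s u = (annInt x s u : ℂ) := by
  rw [annihilation_apply, annInt]
  split_ifs <;> simp [jwSign_eq_cast]

variable [Fintype ι] (G : SimpleGraph ι) [DecidableRel G.Adj]

/-- The entry `(Σ_{x∼y} c†_x c_y)_{s u}` as an integer (so that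
`hoppingMatrix G t s u = -t · hopInt G s u`). [folklore] -/
def hopInt (s u : Finset ι) : ℤ :=
  ∑ x : ι, ∑ y : ι, if G.Adj x y then
    (if x ∈ s ∧ y ∉ s.erase x ∧ u = insert y (s.erase x) then jwInt x (s.erase x) * jwInt y (s.erase x) else 0)
    else 0

/-- `hoppingMatrix G t s u = -t · hopInt G s u`. [folklore] -/
theorem hoppingMatrix_eq_cast (t : ℝ) (s u : Finset ι) :
    hoppingMatrix G t s u = -(t : ℂ) * (hopInt G s u : ℂ) := by
  rw [hoppingMatrix_apply, hopInt]
  congr 1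
  push_cast
  refine Finset.sum_congr rfl fun x _ => Finset.sum_congr rfl fun y _ => ?_
  by_cases h : G.Adj x y
  · rw [if_pos h, if_pos h, creation_mul_annihilation_apply]
    split_ifs <;> simp [jwSign_eq_cast]
  · rw [if_neg h, if_neg h]

end IntEntries

end TwoSpecies

end Literature.MathematicalPhysics.QuantumLattice
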